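import Literature.AlgebraicGeometry.GroupSchemes.SubgroupSchemeFunctorOfPoints
import Literature.AlgebraicGeometry.Morphisms.ContainmentLocusFiniteFlat
import Mathlib.AlgebraicGeometry.Morphisms.Finite
import Mathlib.AlgebraicGeometry.Morphisms.FinitePresentation
import Mathlib.RingTheory.Finiteness.ModuleFinitePresentation
import HarnessLib

/-!
# «Stable closed subgroup scheme of rank `q`» is a CLOSED condition on the Hilbert scheme of `q` points of `G/S`

Layer `Literature/AlgebraicGeometry/GroupSchemes`, namespace `Literature.AlgebraicGeometry.GroupSchemes`.  THEOREMS ONLY (no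
definition, no instance, no notation, no named fact, no `sorry`).  Cell `hodgecm-mathlib` (D-0151), programme P6 «MOD», GENERIC
ORGAN L5.3 (MOD-PLAN v0.9 §5; kit `F0/P6-kit/IwahoriLevel.desk` of A-p07 (g17)), file 2 of the road opened by ★
`GroupSchemes/SubgroupSchemeFunctorOfPoints` (B-p04 (g36)).  Count-neutral Mathlib-side capital: HC_CM is proved only modulo
the 7 printed citations until rung 0 closes; nothing here bears on it.

THE PRINT.  [Liu2021] App. D p. 137 L7–11: the functor `S ↦ {O_𝔭-stable finite flat S-subgroups of u^*E_∞[𝔭] of rank q}` «is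
represented by a finite flat morphism `π : S_{K,Iw} → S_K`».  The GENERIC half of that representability — everything except
the deformation theory of the 1-dimensional formal `𝒪`-module (which gives «finite flat of degree `q + 1`») and the existence of
the Hilbert scheme — is: **inside the Hilbert functor `Hilb^q_{G/S}` (Stacks 0B94) the two conditions «`Z` is a subgroup
scheme of `G_T`» and «`Z` is `act`-stable» are CLOSED**, i.e. cut out, on any family `Ξ ∈ Hilb^q_{G/S}(H)`, by an ideal sheaf
`E` of the base `H` ([MumfordFogartyKirwan1994] Ch. 0 §5 (d) ∕ Ch. 6 Prop. 6.16 «the identities cut out a closed subscheme of the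
base»; [GortzWedhorn2020] Prop. 12.19 for finite locally free morphisms).  Consequently (sequel
`GroupSchemes/SubgroupSchemeModuliOfHilbertScheme`) every Hilbert scheme `(H, Ξ)` of `q` points of `G/S` carries a closed
subscheme `M = V(E) ⊆ H` which, with `Θ := Ξ|_M`, REPRESENTS Liu's functor (`IsStableSubgroupModuli q G act M Θ` of file 1).

THE PROOF.  For `b : T ⟶ H` the pulled-back family `b^*Ξ` has, over `t : W ⟶ T`, the points of `Ξ` over `t ≫ b` (★
`pointsOver_comap_whiskerLeft`), and the universal family `Z = V(Ξ) ⊂ G ×_S H`, read as an `S`-scheme `Z` with its point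
`φ_Z : Z ⟶ G` and structure map `t_Z : Z ⟶ H`, has the universal property «points of `Ξ` over `s : W ⟶ H` = morphisms
`k : W ⟶ Z` with `k ≫ t_Z = s`» (§2).  Hence (Yoneda, §3) each closure property of the points of `b^*Ξ` is ONE containment
«`X ×_H T ⟶ X ⟶ G ×_S H` lands in `Z`» for a universal test object `X → H` that is FINITE LOCALLY FREE over `H`: `X = Z` for
inversion and for each `act a` (test morphism `(φ_Z⁻¹, t_Z)`, `(φ_Z ≫ act a, t_Z)`), `X = Z ×_H Z` for the product (test
morphism `(φ₁ φ₂, t)`), and `X = H` for the unit (no engine needed: `E_1 = (1, 𝟙)^*Ξ`).  ★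
`Morphisms/ContainmentLocusFiniteFlat.exists_idealSheafData_le_ker_iff_le_ker_fst_of_finite_projective_app` turns each
containment into an ideal sheaf of `H` (§1 supplies its «finite projective affine charts» hypothesis from finite + flat +
locally of finite presentation over ANY base, Mathlib `Module.FinitePresentation.of_finite_of_finitePresentation` +
`Module.Flat.projective_of_finitePresentation`), and `E := E_1 ⊔ E_mul ⊔ E_inv ⊔ ⨆ₐ E_a` (§4).

* §1 `finite_projective_app_of_isFinite_of_flat_of_locallyOfFinitePresentation` (any base), `…_of_isFiniteLocallyFreeOfRank`;
* §2 the universal family as an `S`-scheme: `subschemeOverPoint_mem_pointsOver`, `exists_hom_subschemeOver_of_mem_pointsOver`;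
* §3 Yoneda: `comap_le_ker_fst_iff_forall_comp_mem_pointsOver` (generic), and the four conditions one by one;
* §4 **`exists_idealSheafData_le_ker_iff_comap_mem_stableSubgroupFunctorOfPoints`** — the closed condition.

## References
* [Liu2021] Y. Liu, *Fourier–Jacobi cycles and arithmetic relative trace formula*, Camb. J. Math. 9 (2021), App. D p. 137 L7–11.
* [StacksProject] The Stacks Project, Tag 0B94 (Hilbert functor of points); Tag 01QO.
* [MumfordFogartyKirwan1994] D. Mumford, J. Fogarty, F. Kirwan, *Geometric Invariant Theory*, 3rd ed. (1994), Ch. 0 §5 (d)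
  (p. 24), Ch. 6 §3 Prop. 6.16 (p. 126).
* [GortzWedhorn2020] U. Görtz, T. Wedhorn, *Algebraic Geometry I*, 2nd ed. (2020), Def. 12.18 ∕ Prop. 12.19 (pp. 331–332),
  Def. 4.42 ∕ (4.15) (pp. 116–117).
-/

noncomputable section

-- Mathlib's `Over`/pull-back API is stated across semireducible wrappers (as in the ★ `GroupSchemes/*` files).
set_option backward.isDefEq.respectTransparency false

open CategoryTheory CategoryTheory.Limits AlgebraicGeometry MonoidalCategory CartesianMonoidalCategory
open scoped MonObj

universe v u

namespace Literature.AlgebraicGeometry.GroupSchemes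

open Literature.AlgebraicGeometry.HilbertScheme Literature.AlgebraicGeometry.Morphisms

/-! ## §1 Finite + flat + locally of finite presentation ⇒ finite projective affine charts (any base) -/

/-- **A finite, flat, locally finitely presented morphism has finite projective affine charts** — the hypothesis of ★
`Morphisms/ContainmentLocusFiniteFlat` — over ANY base: on an affine open `W`, `Γ(X, p⁻¹W)` is a finite (`IsFinite`), flat
(`Flat`) `Γ(S, W)`-module which is finitely presented as an ALGEBRA (`LocallyOfFinitePresentation`), hence finitely presented
as a module (Mathlib `Module.FinitePresentation.of_finite_of_finitePresentation`, Stacks 0564), hence projective (Mathlib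
`Module.Flat.projective_of_finitePresentation`).  ★ `finite_projective_app_of_isFinite_of_flat` is the locally noetherian case.
[cite: GortzWedhorn2020, Definition 12.18 and Proposition 12.19 (pp. 331–332)] [cite: StacksProject, Tag 02KB] -/
theorem finite_projective_app_of_isFinite_of_flat_of_locallyOfFinitePresentation {X S : Scheme.{u}} (p : X ⟶ S)
    [IsFinite p] [Flat p] [LocallyOfFinitePresentation p] (s : S) :
    ∃ W : S.Opens, s ∈ W ∧ IsAffineOpen W ∧
      letI := (p.app W).hom.toAlgebra
      Module.Finite Γ(S, W) Γ(X, p ⁻¹ᵁ W) ∧ Module.Projective Γ(S, W) Γ(X, p ⁻¹ᵁ W) := by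
  obtain ⟨_, ⟨W, hW, rfl⟩, hsW, -⟩ :=
    S.isBasis_affineOpens.exists_subset_of_mem_open (Set.mem_univ s) isOpen_univ
  letI : Algebra Γ(S, W) Γ(X, p ⁻¹ᵁ W) := (p.app W).hom.toAlgebra
  have hfin : Module.Finite Γ(S, W) Γ(X, p ⁻¹ᵁ W) := p.finite_app W hW
  have hflat : Module.Flat Γ(S, W) Γ(X, p ⁻¹ᵁ W) := by
    have h := p.flat_appLE hW (hW.preimage p) le_rfl
    rw [← Scheme.Hom.app_eq_appLE] at h
    exact h
  have hfp : Algebra.FinitePresentation Γ(S, W) Γ(X, p ⁻¹ᵁ W) := by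
    have h : RingHom.FinitePresentation (p.appLE W (p ⁻¹ᵁ W) le_rfl).hom :=
      HasRingHomProperty.appLE (P := @LocallyOfFinitePresentation) (f := p) ‹_› ⟨W, hW⟩ ⟨p ⁻¹ᵁ W, hW.preimage p⟩
        le_rfl
    rw [← Scheme.Hom.app_eq_appLE] at h
    exact h
  haveI : Module.FinitePresentation Γ(S, W) Γ(X, p ⁻¹ᵁ W) :=
    Module.FinitePresentation.of_finite_of_finitePresentation Γ(S, W) Γ(X, p ⁻¹ᵁ W)
  exact ⟨W, hsW, hW, hfin, Module.Flat.projective_of_finitePresentation⟩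

/-- The same for a morphism finite locally free of rank `n` (★ `IsFiniteLocallyFreeOfRank`).
[cite: StacksProject, Tag 02KB] [cite: GortzWedhorn2020, Definition 12.18 and Proposition 12.19 (pp. 331–332)] -/
theorem finite_projective_app_of_isFiniteLocallyFreeOfRank {n : ℕ} {X S : Scheme.{u}} {p : X ⟶ S}
    (hp : IsFiniteLocallyFreeOfRank n p) (s : S) :
    ∃ W : S.Opens, s ∈ W ∧ IsAffineOpen W ∧
      letI := (p.app W).hom.toAlgebra
      Module.Finite Γ(S, W) Γ(X, p ⁻¹ᵁ W) ∧ Module.Projective Γ(S, W) Γ(X, p ⁻¹ᵁ W) :=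
  haveI := hp.isFinite
  haveI := hp.flat
  haveI := hp.locallyOfFinitePresentation
  finite_projective_app_of_isFinite_of_flat_of_locallyOfFinitePresentation p s

/-! ## §2 The family `Z_Ξ = V(Ξ) ⊂ G ×_S H` as an `S`-scheme: its point `φ_Z`, its structure map `t_Z`, its universal property -/

section Family

variable {S : Scheme.{u}} {G H : Over S} (Ξ : (G ⊗ H).left.IdealSheafData)

/-- The tautological point: for the `S`-scheme `Z := (V(Ξ) → G ×_S H → S)` with `φ_Z := Z → G ×_S H → G` and
`t_Z := Z → G ×_S H → H`, one has `(φ_Z, t_Z) = (Z ↪ G ×_S H)`, so `φ_Z` is a point of `Ξ` over `t_Z`.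
[cite: StacksProject, Tag 0B94] [cite: GortzWedhorn2020, Definition 4.42 and (4.15), pp. 116–117] -/
theorem subschemeOverPoint_mem_pointsOver :
    (Over.homMk Ξ.subschemeι rfl ≫ fst G H : Over.mk (Ξ.subschemeι ≫ (G ⊗ H).hom) ⟶ G) ∈
      pointsOver Ξ (Over.homMk Ξ.subschemeι rfl ≫ snd G H : Over.mk (Ξ.subschemeι ≫ (G ⊗ H).hom) ⟶ H) := by
  rw [mem_pointsOver_iff, ← comp_lift, lift_fst_snd, Category.comp_id]
  change Ξ ≤ Ξ.subschemeι.ker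
  rw [Scheme.IdealSheafData.ker_subschemeι]

/-- A morphism into `Z` gives a point of `Ξ`: for `k : W ⟶ Z`, `k ≫ φ_Z ∈ pointsOver Ξ (k ≫ t_Z)`.
[cite: StacksProject, Tag 0B94] [cite: GortzWedhorn2020, Definition 4.42 and (4.15), pp. 116–117] -/
theorem comp_subschemeOverPoint_mem_pointsOver {W : Over S} (k : W ⟶ Over.mk (Ξ.subschemeι ≫ (G ⊗ H).hom)) :
    k ≫ (Over.homMk Ξ.subschemeι rfl ≫ fst G H) ∈ pointsOver Ξ (k ≫ (Over.homMk Ξ.subschemeι rfl ≫ snd G H)) :=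
  comp_mem_pointsOver (subschemeOverPoint_mem_pointsOver Ξ) k

/-- **Universal property of the family**: a point `φ` of `Ξ` over `s : W ⟶ H` comes from a (unique) morphism `k : W ⟶ Z` with
`k ≫ φ_Z = φ` and `k ≫ t_Z = s` (the graph `(φ, s)` factors through the closed immersion `Z ↪ G ×_S H`).
[cite: StacksProject, Tag 01QO] [cite: GortzWedhorn2020, Definition 4.42 and (4.15), pp. 116–117] -/
theorem exists_hom_subschemeOver_of_mem_pointsOver {W : Over S} {s : W ⟶ H} {φ : W ⟶ G} (hφ : φ ∈ pointsOver Ξ s) :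
    ∃ k : W ⟶ Over.mk (Ξ.subschemeι ≫ (G ⊗ H).hom),
      k ≫ (Over.homMk Ξ.subschemeι rfl ≫ fst G H) = φ ∧ k ≫ (Over.homMk Ξ.subschemeι rfl ≫ snd G H) = s := by
  obtain ⟨k₀, hk₀⟩ := (mem_pointsOver_iff_exists_lift Ξ s φ).1 hφ
  have hw : k₀ ≫ (Over.mk (Ξ.subschemeι ≫ (G ⊗ H).hom)).hom = W.hom := by
    change k₀ ≫ Ξ.subschemeι ≫ (G ⊗ H).hom = W.hom
    rw [← Category.assoc, hk₀, Over.w]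
  refine ⟨Over.homMk k₀ hw, ?_, ?_⟩
  · ext : 1
    change k₀ ≫ Ξ.subschemeι ≫ (fst G H).left = φ.left
    rw [← Category.assoc, hk₀, ← Over.comp_left, lift_fst]
  · ext : 1
    change k₀ ≫ Ξ.subschemeι ≫ (snd G H).left = s.left
    rw [← Category.assoc, hk₀, ← Over.comp_left, lift_snd]

end Family

/-! ## §3 Yoneda: a closure property of the points of `b^*Ξ` is ONE containment for a universal test object over `H` -/

section Yoneda

variable {S : Scheme.{u}} {G H : Over S} (Ξ : (G ⊗ H).left.IdealSheafData)

/-- **Generic Yoneda step.**  Let `X` be an `S`-scheme with `p : X ⟶ H` and a «test point» `m : X ⟶ G`, and `b : T ⟶ H`.  Then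
«`X ×_H T ⟶ X ⟶ G ×_S H` lands in `Z_Ξ`», i.e. `((m, p)^* Ξ) ≤ ker (X ×_H T ⟶ X)` — the CONTAINMENT condition of ★
`Morphisms/ContainmentLocusFiniteFlat` for the closed subscheme `(m, p)⁻¹ Z_Ξ ⊆ X` — iff for every `x : W ⟶ X` and `t : W ⟶ T`
with `x ≫ p = t ≫ b` the point `x ≫ m` lies in `Z_Ξ` over `t ≫ b`. [cite: MumfordFogartyKirwan1994, Ch. 6 §3 Prop. 6.16 (p. 126)]
[cite: StacksProject, Tag 0B94] -/
theorem comap_le_ker_fst_iff_forall_comp_mem_pointsOver {X T : Over S} (p : X ⟶ H) (m : X ⟶ G) (b : T ⟶ H) :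
    Ξ.comap (lift m p).left ≤ (pullback.fst p.left b.left).ker ↔
      ∀ ⦃W : Over S⦄ (x : W ⟶ X) (t : W ⟶ T), x ≫ p = t ≫ b → x ≫ m ∈ pointsOver Ξ (t ≫ b) := by
  constructor
  · intro h W x t hxt
    -- the pair `(x, t)` is a `W`-point of `X ×_H T`
    let w : W.left ⟶ pullback p.left b.left :=
      pullback.lift x.left t.left (by rw [← Over.comp_left, hxt, Over.comp_left])
    have hw : w ≫ pullback.fst p.left b.left = x.left := pullback.lift_fst _ _ _
    rw [mem_pointsOver_iff, ← hxt, ← comp_lift, Over.comp_left, ← hw, le_ker_comp_iff_comap_le]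
    exact h.trans (Scheme.Hom.le_ker_comp _ _)
  · intro h
    -- the universal pair: `X ×_H T` with its two projections, as `S`-morphisms
    let XT : Over S := Over.mk (pullback.snd p.left b.left ≫ T.hom)
    have hx : pullback.fst p.left b.left ≫ X.hom = XT.hom := by
      change pullback.fst p.left b.left ≫ X.hom = pullback.snd p.left b.left ≫ T.hom
      rw [← Over.w p, ← Category.assoc, pullback.condition, Category.assoc, Over.w b]
    let x : XT ⟶ X := Over.homMk (pullback.fst p.left b.left) hx
    let t : XT ⟶ T := Over.homMk (pullback.snd p.left b.left) rfl
    have hxt : x ≫ p = t ≫ b := by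
      ext : 1
      exact pullback.condition
    have key := h x t hxt
    rw [mem_pointsOver_iff, ← hxt, ← comp_lift, Over.comp_left, le_ker_comp_iff_comap_le] at key
    exact key

variable [GrpObj G] {Z : Over S} (φZ : Z ⟶ G) (tZ : Z ⟶ H)

/-- **Inversion.**  Let `(Z, φ_Z, t_Z)` read the family `Ξ` (`φ_Z ∈ pointsOver Ξ t_Z`, and every point of `Ξ` over `s` comes from
a morphism `k : W ⟶ Z` with `k ≫ φ_Z = φ`, `k ≫ t_Z = s` — §2).  The points of `b^*Ξ` are closed under `φ ↦ φ⁻¹` (over every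
`t : W ⟶ T`) iff the containment condition holds for the test object `t_Z : Z → H` with test point `φ_Z⁻¹`.
[cite: GortzWedhorn2020, Definition 4.42 and (4.15), pp. 116–117] [cite: MumfordFogartyKirwan1994, Ch. 6 §3 Prop. 6.16 (p. 126)] -/
theorem forall_inv_mem_pointsOver_comap_iff (hZ : φZ ∈ pointsOver Ξ tZ)
    (huniv : ∀ ⦃W : Over S⦄ ⦃s : W ⟶ H⦄ ⦃φ : W ⟶ G⦄, φ ∈ pointsOver Ξ s → ∃ k : W ⟶ Z, k ≫ φZ = φ ∧ k ≫ tZ = s)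
    {T : Over S} (b : T ⟶ H) :
    (∀ ⦃W : Over S⦄ (t : W ⟶ T) ⦃φ : W ⟶ G⦄,
        φ ∈ pointsOver (Ξ.comap (G ◁ b).left) t → φ⁻¹ ∈ pointsOver (Ξ.comap (G ◁ b).left) t) ↔
      Ξ.comap (lift φZ⁻¹ tZ).left ≤ (pullback.fst tZ.left b.left).ker := by
  rw [comap_le_ker_fst_iff_forall_comp_mem_pointsOver]
  constructor
  · intro h W x t hxt
    rw [GrpObj.comp_inv, ← pointsOver_comap_whiskerLeft]
    apply h t
    rw [pointsOver_comap_whiskerLeft, ← hxt]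
    exact comp_mem_pointsOver hZ x
  · intro h W t φ hφ
    rw [pointsOver_comap_whiskerLeft] at hφ ⊢
    obtain ⟨k, hkφ, hkt⟩ := huniv hφ
    have := h k t hkt
    rwa [GrpObj.comp_inv, hkφ] at this

omit [GrpObj G] in
/-- **Translation by an endomorphism `a : G ⟶ G`** (same reading of `Ξ` by `(Z, φ_Z, t_Z)`).  The points of `b^*Ξ` are stable
under `φ ↦ φ ≫ a` iff the containment condition holds for the test object `t_Z : Z → H` with test point `φ_Z ≫ a`.
[cite: Liu2021, Appendix D, p. 137 L7–11] [cite: MumfordFogartyKirwan1994, Ch. 6 §3 Prop. 6.16 (p. 126)] -/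
theorem forall_comp_mem_pointsOver_comap_iff (hZ : φZ ∈ pointsOver Ξ tZ)
    (huniv : ∀ ⦃W : Over S⦄ ⦃s : W ⟶ H⦄ ⦃φ : W ⟶ G⦄, φ ∈ pointsOver Ξ s → ∃ k : W ⟶ Z, k ≫ φZ = φ ∧ k ≫ tZ = s)
    (a : G ⟶ G) {T : Over S} (b : T ⟶ H) :
    (∀ ⦃W : Over S⦄ (t : W ⟶ T) ⦃φ : W ⟶ G⦄,
        φ ∈ pointsOver (Ξ.comap (G ◁ b).left) t → φ ≫ a ∈ pointsOver (Ξ.comap (G ◁ b).left) t) ↔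
      Ξ.comap (lift (φZ ≫ a) tZ).left ≤ (pullback.fst tZ.left b.left).ker := by
  rw [comap_le_ker_fst_iff_forall_comp_mem_pointsOver]
  constructor
  · intro h W x t hxt
    rw [← Category.assoc, ← pointsOver_comap_whiskerLeft]
    apply h t
    rw [pointsOver_comap_whiskerLeft, ← hxt]
    exact comp_mem_pointsOver hZ x
  · intro h W t φ hφ
    rw [pointsOver_comap_whiskerLeft] at hφ ⊢
    obtain ⟨k, hkφ, hkt⟩ := huniv hφ
    have := h k t hkt
    rwa [← Category.assoc, hkφ] at this

/-- **Product.**  Same reading of `Ξ` by `(Z, φ_Z, t_Z)`, and let `(X, k₁, k₂)` read `Z ×_H Z` (`k₁ ≫ t_Z = k₂ ≫ t_Z`, and every pair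
`l₁, l₂ : W ⟶ Z` with `l₁ ≫ t_Z = l₂ ≫ t_Z` factors as `x ≫ k₁, x ≫ k₂`).  The points of `b^*Ξ` are closed under multiplication iff
the containment condition holds for the test object `X → H` with test point `(k₁ ≫ φ_Z) · (k₂ ≫ φ_Z)`.
[cite: GortzWedhorn2020, Definition 4.42 and (4.15), pp. 116–117] [cite: MumfordFogartyKirwan1994, Ch. 6 §3 Prop. 6.16 (p. 126)] -/
theorem forall_mul_mem_pointsOver_comap_iff (hZ : φZ ∈ pointsOver Ξ tZ)
    (huniv : ∀ ⦃W : Over S⦄ ⦃s : W ⟶ H⦄ ⦃φ : W ⟶ G⦄, φ ∈ pointsOver Ξ s → ∃ k : W ⟶ Z, k ≫ φZ = φ ∧ k ≫ tZ = s)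
    {X : Over S} (k₁ k₂ : X ⟶ Z) (hk : k₁ ≫ tZ = k₂ ≫ tZ)
    (hX : ∀ ⦃W : Over S⦄ (l₁ l₂ : W ⟶ Z), l₁ ≫ tZ = l₂ ≫ tZ → ∃ x : W ⟶ X, x ≫ k₁ = l₁ ∧ x ≫ k₂ = l₂)
    {T : Over S} (b : T ⟶ H) :
    (∀ ⦃W : Over S⦄ (t : W ⟶ T) ⦃φ ψ : W ⟶ G⦄, φ ∈ pointsOver (Ξ.comap (G ◁ b).left) t →
        ψ ∈ pointsOver (Ξ.comap (G ◁ b).left) t → φ * ψ ∈ pointsOver (Ξ.comap (G ◁ b).left) t) ↔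
      Ξ.comap (lift ((k₁ ≫ φZ) * (k₂ ≫ φZ)) (k₁ ≫ tZ)).left ≤ (pullback.fst (k₁ ≫ tZ).left b.left).ker := by
  rw [comap_le_ker_fst_iff_forall_comp_mem_pointsOver]
  constructor
  · intro h W x t hxt
    rw [MonObj.comp_mul, ← pointsOver_comap_whiskerLeft]
    apply h t
    · rw [pointsOver_comap_whiskerLeft, ← hxt, ← Category.assoc, Category.assoc]
      exact comp_mem_pointsOver hZ (x ≫ k₁)
    · rw [pointsOver_comap_whiskerLeft, ← hxt, ← Category.assoc, Category.assoc, hk]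
      exact comp_mem_pointsOver hZ (x ≫ k₂)
  · intro h W t φ ψ hφ hψ
    rw [pointsOver_comap_whiskerLeft] at hφ hψ ⊢
    obtain ⟨l₁, hl₁φ, hl₁t⟩ := huniv hφ
    obtain ⟨l₂, hl₂ψ, hl₂t⟩ := huniv hψ
    obtain ⟨x, hx₁, hx₂⟩ := hX l₁ l₂ (hl₁t.trans hl₂t.symm)
    have hxt : x ≫ (k₁ ≫ tZ) = t ≫ b := by rw [← Category.assoc, hx₁, hl₁t]
    have := h x t hxt
    rwa [MonObj.comp_mul, ← Category.assoc, ← Category.assoc, hx₁, hx₂, hl₁φ, hl₂ψ] at this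

/-- **Unit.**  The unit point lies in `b^*Ξ` over every `t : W ⟶ T` iff `b` factors through the closed subscheme
`V((1, 𝟙)^*Ξ) ⊆ H` (no test object needed: `(1, t ≫ b) = t ≫ b ≫ (1, 𝟙_H)`).
[cite: GortzWedhorn2020, Definition 4.42 and (4.15), pp. 116–117] [cite: StacksProject, Tag 01QO] -/
theorem forall_one_mem_pointsOver_comap_iff {T : Over S} (b : T ⟶ H) :
    (∀ ⦃W : Over S⦄ (t : W ⟶ T), (1 : W ⟶ G) ∈ pointsOver (Ξ.comap (G ◁ b).left) t) ↔
      Ξ.comap (lift (1 : H ⟶ G) (𝟙 H)).left ≤ b.left.ker := by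
  constructor
  · intro h
    have h1 := h (𝟙 T)
    rw [pointsOver_comap_whiskerLeft, Category.id_comp, mem_pointsOver_iff] at h1
    rw [← le_ker_comp_iff_comap_le, ← Over.comp_left, comp_lift, MonObj.comp_one, Category.comp_id]
    exact h1
  · intro h W t
    rw [pointsOver_comap_whiskerLeft, mem_pointsOver_iff]
    have e : lift (1 : W ⟶ G) (t ≫ b) = (t ≫ b) ≫ lift (1 : H ⟶ G) (𝟙 H) := by
      rw [comp_lift, MonObj.comp_one, Category.comp_id]
    rw [e, Over.comp_left, le_ker_comp_iff_comap_le, Over.comp_left]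
    exact h.trans (Scheme.Hom.le_ker_comp _ _)

end Yoneda

/-! ## §4 The closed condition on the base of any family `Ξ ∈ Hilb^q_{G/S}(H)` -/

section Closed

variable {S : Scheme.{u}} {G H : Over S} [GrpObj G] {O : Type v} (act : O → (G ⟶ G)) (q : ℕ)
  (Ξ : (G ⊗ H).left.IdealSheafData)

/-- `IsSubgroupIdeal` unfolded into its three closure properties. [cite: GortzWedhorn2020, Definition 4.42 and (4.15), pp. 116–117] -/
theorem isSubgroupIdeal_iff {T : Over S} (I : (G ⊗ T).left.IdealSheafData) :
    IsSubgroupIdeal G T I ↔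
      (∀ ⦃W : Over S⦄ (t : W ⟶ T), (1 : W ⟶ G) ∈ pointsOver I t) ∧
      (∀ ⦃W : Over S⦄ (t : W ⟶ T) ⦃φ ψ : W ⟶ G⦄,
          φ ∈ pointsOver I t → ψ ∈ pointsOver I t → φ * ψ ∈ pointsOver I t) ∧
      (∀ ⦃W : Over S⦄ (t : W ⟶ T) ⦃φ : W ⟶ G⦄, φ ∈ pointsOver I t → φ⁻¹ ∈ pointsOver I t) :=
  ⟨fun h => ⟨h.one_mem, h.mul_mem, h.inv_mem⟩, fun h => ⟨h.1, h.2.1, h.2.2⟩⟩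

/-- **THE CLOSED CONDITION.**  For ANY family `Ξ ∈ Hilb^q_{G/S}(H)` (`Z_Ξ → H` finite locally free of rank `q`) of closed
subschemes of the `S`-group scheme `G`, and any endomorphisms `act : O → (G ⟶ G)`, there is an ideal sheaf `E` of the base `H`
such that a base change `b : T ⟶ H` factors through `V(E)` iff the pulled-back family `b^*Ξ ⊂ G ×_S T` is an `act`-STABLE
closed SUBGROUP scheme of `G_T` (it is then automatically finite locally free of rank `q`): `E ≤ ker b ↔ b^*Ξ ∈ S_{Iw}(T)`.
`E = (1,𝟙)^*Ξ ⊔ E_mul ⊔ E_inv ⊔ ⨆ₐ E_a`, the last three from ★ `ContainmentLocusFiniteFlat` on the finite locally free test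
objects `Z_Ξ ×_H Z_Ξ`, `Z_Ξ`, `Z_Ξ` over `H` (§3).  [cite: MumfordFogartyKirwan1994, Ch. 6 §3 Prop. 6.16 (p. 126)]
[cite: Liu2021, Appendix D, p. 137 L7–11] [cite: StacksProject, Tag 0B94]
[cite: GortzWedhorn2020, Definition 12.18 and Proposition 12.19 (pp. 331–332)] -/
theorem exists_idealSheafData_le_ker_iff_comap_mem_stableSubgroupFunctorOfPoints
    (hΞ : Ξ ∈ hilbertFunctorOfPoints q G H) :
    ∃ E : H.left.IdealSheafData, ∀ ⦃T : Over S⦄ (b : T ⟶ H),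
      E ≤ b.left.ker ↔ Ξ.comap (G ◁ b).left ∈ stableSubgroupFunctorOfPoints q G act T := by
  -- the reading `(Z, φ_Z, t_Z)` of `Ξ`
  let Z : Over S := Over.mk (Ξ.subschemeι ≫ (G ⊗ H).hom)
  let jZ : Z ⟶ G ⊗ H := Over.homMk Ξ.subschemeι rfl
  let φZ : Z ⟶ G := jZ ≫ fst G H
  let tZ : Z ⟶ H := jZ ≫ snd G H
  have hZ : φZ ∈ pointsOver Ξ tZ := subschemeOverPoint_mem_pointsOver Ξ
  have huniv : ∀ ⦃W : Over S⦄ ⦃s : W ⟶ H⦄ ⦃φ : W ⟶ G⦄, φ ∈ pointsOver Ξ s →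
      ∃ k : W ⟶ Z, k ≫ φZ = φ ∧ k ≫ tZ = s :=
    fun W s φ hφ => exists_hom_subschemeOver_of_mem_pointsOver Ξ hφ
  -- `t_Z : Z → H` is finite locally free of rank `q`
  have htZ : IsFiniteLocallyFreeOfRank q tZ.left := hΞ
  haveI : IsFinite tZ.left := htZ.isFinite
  haveI : Flat tZ.left := htZ.flat
  haveI : LocallyOfFinitePresentation tZ.left := htZ.locallyOfFinitePresentation
  haveI : IsAffineHom tZ.left := inferInstance
  -- the reading `(X, k₁, k₂)` of `Z ×_H Z`
  let X : Over S := Over.mk (pullback.fst tZ.left tZ.left ≫ Z.hom)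
  let k₁ : X ⟶ Z := Over.homMk (pullback.fst tZ.left tZ.left) rfl
  have hk₂w : pullback.snd tZ.left tZ.left ≫ Z.hom = X.hom := by
    change pullback.snd tZ.left tZ.left ≫ Z.hom = pullback.fst tZ.left tZ.left ≫ Z.hom
    rw [← Over.w tZ, ← Category.assoc, ← pullback.condition, Category.assoc]
  let k₂ : X ⟶ Z := Over.homMk (pullback.snd tZ.left tZ.left) hk₂w
  have hk : k₁ ≫ tZ = k₂ ≫ tZ := by
    ext : 1
    exact pullback.condition
  have hX : ∀ ⦃W : Over S⦄ (l₁ l₂ : W ⟶ Z), l₁ ≫ tZ = l₂ ≫ tZ → ∃ x : W ⟶ X, x ≫ k₁ = l₁ ∧ x ≫ k₂ = l₂ := by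
    intro W l₁ l₂ hl
    have hl' : l₁.left ≫ tZ.left = l₂.left ≫ tZ.left := by rw [← Over.comp_left, hl, Over.comp_left]
    refine ⟨Over.homMk (pullback.lift l₁.left l₂.left hl') ?_, ?_, ?_⟩
    · change pullback.lift l₁.left l₂.left hl' ≫ pullback.fst tZ.left tZ.left ≫ Z.hom = W.hom
      rw [pullback.lift_fst_assoc, Over.w]
    · ext : 1
      exact pullback.lift_fst _ _ _
    · ext : 1
      exact pullback.lift_snd _ _ _
  haveI : IsFinite (k₁ ≫ tZ).left := by
    change IsFinite (pullback.fst tZ.left tZ.left ≫ tZ.left); infer_instance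
  haveI : Flat (k₁ ≫ tZ).left := by
    change Flat (pullback.fst tZ.left tZ.left ≫ tZ.left); infer_instance
  haveI : LocallyOfFinitePresentation (k₁ ≫ tZ).left := by
    change LocallyOfFinitePresentation (pullback.fst tZ.left tZ.left ≫ tZ.left); infer_instance
  haveI : IsAffineHom (k₁ ≫ tZ).left := inferInstance
  -- the three closed conditions produced by the engine
  obtain ⟨Emul, hEmul⟩ := exists_idealSheafData_le_ker_iff_le_ker_fst_of_finite_projective_app (k₁ ≫ tZ).left
    (Ξ.comap (lift ((k₁ ≫ φZ) * (k₂ ≫ φZ)) (k₁ ≫ tZ)).left)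
    (finite_projective_app_of_isFinite_of_flat_of_locallyOfFinitePresentation (k₁ ≫ tZ).left)
  obtain ⟨Einv, hEinv⟩ := exists_idealSheafData_le_ker_iff_le_ker_fst_of_finite_projective_app tZ.left
    (Ξ.comap (lift φZ⁻¹ tZ).left)
    (finite_projective_app_of_isFinite_of_flat_of_locallyOfFinitePresentation tZ.left)
  choose Eact hEact using fun a : O =>
    exists_idealSheafData_le_ker_iff_le_ker_fst_of_finite_projective_app tZ.left
      (Ξ.comap (lift (φZ ≫ act a) tZ).left)
      (finite_projective_app_of_isFinite_of_flat_of_locallyOfFinitePresentation tZ.left)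
  refine ⟨((Ξ.comap (lift (1 : H ⟶ G) (𝟙 H)).left ⊔ Emul) ⊔ Einv) ⊔ ⨆ a, Eact a, fun T b => ?_⟩
  rw [sup_le_iff, sup_le_iff, sup_le_iff, iSup_le_iff, mem_stableSubgroupFunctorOfPoints_iff, isSubgroupIdeal_iff,
    ← forall_one_mem_pointsOver_comap_iff Ξ b, hEmul b.left,
    ← forall_mul_mem_pointsOver_comap_iff Ξ φZ tZ hZ huniv k₁ k₂ hk hX b, hEinv b.left,
    ← forall_inv_mem_pointsOver_comap_iff Ξ φZ tZ hZ huniv b]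
  have hact : (∀ a, Eact a ≤ b.left.ker) ↔ IsStableIdeal act T (Ξ.comap (G ◁ b).left) := by
    constructor
    · intro h W t φ hφ a
      exact (forall_comp_mem_pointsOver_comap_iff Ξ φZ tZ hZ huniv (act a) b).2 ((hEact a b.left).1 (h a)) t hφ
    · intro h a
      exact (hEact a b.left).2 ((forall_comp_mem_pointsOver_comap_iff Ξ φZ tZ hZ huniv (act a) b).1
        fun W t φ hφ => h t hφ a)
  rw [hact]
  have hmem : Ξ.comap (G ◁ b).left ∈ hilbertFunctorOfPoints q G T := comap_whiskerLeft_mem hΞ b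
  tauto

end Closed



end Literature.AlgebraicGeometry.GroupSchemes

end
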